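import Summits.AtomisticToContinuum.Crystallization.Theorems.GappedShellCensusRadialDefectsVanishLocallyTwelveGap
import Summits.AtomisticToContinuum.Crystallization.Theorems.GappedShellCensusRadialDefectsVanishLtgOfAllTwelveGap

/-!
# SKELETON — crux `GappedShellCensus.RadialDefectsVanish` (stmt-AtomisticToContinuum-15930), line `all-twelve-gap`
# (crux-strategist s3, 2026-08-17; ADOPTED as the LIVE line by lead c3, 2026-08-17T16:45Z — rev 2: the compactness stub is now the
# landed theorem `Theorems.stub_ltgOfAllTwelveGap` (p169958), so the open stubs are exactly stub_twelveWithinOne (foreign, item 15808),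
# stub_tammesThirteen (foreign, Literature named fact) and stub_allTwelveGap (OWN).)

THE MOVE (pass to the limit object).  The live line's own stub `stub_locallyTwelveGap` is a statement about FINITE clusters at
a hand-picked locality radius `R = 7/2`.  Its `R → ∞` limit object is an INFINITE point set `Y ⊂ ℝ³` in which EVERY site is
locally twelve (`55/57`-separated from all other sites, exactly twelve other sites within distance `1`).  This line replaces
the finite stub by

* `stub_allTwelveGap` (NEW, OWN; pure discrete geometry on infinite all-locally-twelve sets, GS-free): such a `Y` has no pair
  of sites at distance in the half-open annulus `(1, 21/17]` — the `3.5 %`-tolerant, everywhere-twelve form of Hales' 2012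
  lemma "kissing number twelve everywhere ⇒ no centre distance in `(2, 2.52)`", stated on the limit object.  It is implied by
  every finite-radius statement `LTG_R` whose gap end is `> 21/17` (restrict `Y` to a ball), by every periodic / infinite-volume
  argument, and — unlike `LTG_{7/2}` — it is refuted ONLY by witnesses that extend to an everywhere-twelve configuration of
  space (a finite exotic cluster does not kill it);
* `stub_ltgOfAllTwelveGap` (NEW, OWN; pure analysis — PROVED sorry-free by the strategist, 2026-08-17: standalone Theorems-ready
  file `Lines/all_twelve_gap_LtgOfAllTwelveGap.lean`, proposed as `Theorems/GappedShellCensusRadialDefectsVanishLtgOfAllTwelveGap.lean`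
  `--supports stmt-15930`; kept here as a registered stub until the gate lands it): COMPACTNESS — if the
  thick thirteen-spheres bound holds and `AllTwelveGap` holds, then the finite statement `LTG_n` holds at SOME locality
  radius `n : ℕ`.  Proof sketch: otherwise pick, for every `n`, a finite cluster locally twelve out to `n` around a root with
  an annulus neighbour; root it at `0`, truncate to the `n`-ball, view it in the compact local-rubber space
  `LocalConfig ℝ³` (`Literature/Probability/Process/LocalRubber*`: `exists_tendsto_subseq`, rooted `55/57`-hard-core
  configurations are a closed class); the limit `Y` is `55/57`-separated, rooted, locally finite
  (`finite_inter_of_separated`), every site keeps `≥ 12` neighbours within `1` (matching + finite stabilisation) and has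
  `≤ 12` by `ThickThirteen`; the annulus neighbours accumulate either at norm `1` (then the root has `13` sites within `1`,
  contradicting `ThickThirteen`) or at a site of `Y` of norm in `(1, 21/17]`, contradicting `AllTwelveGap`;
* the two foreign stubs of the live line, unchanged (same names, same registered signatures): `stub_twelveWithinOne`
  (= hub item stmt-AtomisticToContinuum-15808, ENERGY) and `stub_tammesThirteen` (the Literature named fact).

Composition `RadialDefectsVanish_of` (PROVED, the crux BY NAME): `stub_ltgOfAllTwelveGap` fed with `ThickThirteen`
(`RdvSplit.stub_thickThirteen_of_tammes`, p136458) yields `LTG_n` for some `n`, and the landed any-radius glue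
`radialDefectsVanish_of_locallyTwelveGapAt` (p151785; inside: `RadialDefectsVanish_of_subs_at`, p136971, scale `a = 50/51`)
concludes.  Sorries: exactly the four `stub_*` (of which `stub_ltgOfAllTwelveGap` is already proved, see above); net
`RadialDefectsVanish ⇐ TwelveWithinOne (15808) ∧ Tammes-13 (Literature fact) ∧ AllTwelveGap`.

Why it dodges the STUCK goal of the live line: the lead's census pins the live line on ONE item-sized certified computation
(`stub_locallyTwelveGap`, margin 3 % shell-only / 5–9 % with the annulus site twelve, no human proof).  This line does not
make that computation easier; it makes the TARGET of the computation canonical and strictly more inclusive (any radius, any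
certificate with gap end `> 21/17`, any infinite-volume argument closes `stub_allTwelveGap`), moves the choice of the locality
radius from the statement into the proof (`∃ n`), and isolates the only non-geometric work in a compactness stub that is
already proved.  Negation probe of `stub_allTwelveGap`: kit job j026982 (periodic all-twelve structures, minimise the 13th
distance; analytic bct/Bain value `2√(s²−1/2) = 1.3131 > 21/17`).
Disproof used (Cruxes/RadialDefectsVanish/Disproof.lean): §6 minimality is load-bearing — honoured inside `stub_twelveWithinOne`
only (both own stubs are GS-free by design; `radialDefectsVanish_false_without_GS`'s dilated-line witness is not locally
twelve); §1–2 the scale is SELECTED (`a = 50/51` inside the landed glue); N4/N6 one-centre tolerant L12 is FALSE — honoured: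
`stub_allTwelveGap` assumes EVERY site twelve-coordinated (the strongest k-centre hypothesis), not just the root.
-/

noncomputable section

open scoped BigOperators Topology Classical
open Filter Finset
open Literature.MathematicalPhysics.StatisticalMechanics
open Literature.Geometry.DiscreteGeometry (musinTarasov2012_tammes_thirteen)

namespace Summit.AtomisticToContinuum.Crystallization.Cruxes.RadialDefectsVanish.AllTwelveGap

/-! ## The registered stubs -/

/-- STUB 1 (foreign: = hub item stmt-AtomisticToContinuum-15808 `SquareWellLayerCake.TwelveWithinOne`, verbatim; ENERGY,
one-sided; registered on stmt-15930 under this name since Sketch rev 3). -/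
theorem stub_twelveWithinOne : ∀ x : (N : ℕ) → (Fin N → EuclideanSpace ℝ (Fin 3)), (∀ N, Literature.MathematicalPhysics.StatisticalMechanics.IsGroundState Literature.MathematicalPhysics.StatisticalMechanics.lennardJones (x N)) → Filter.Tendsto (fun N : ℕ => (Nat.card {i : Fin N // ¬ ((∀ j : Fin N, dist (x N i) (x N j) ≤ 11 / 10 → ∀ k : Fin N, k ≠ j → (55 : ℝ) / 57 ≤ dist (x N j) (x N k)) ∧ 12 ≤ (Finset.univ.filter fun j : Fin N => j ≠ i ∧ dist (x N i) (x N j) ≤ 1).card)} : ℝ) / N) Filter.atTop (nhds 0) := by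
  sorry

/-- STUB 2 (foreign: = the Literature named fact `musinTarasov2012_tammes_thirteen`, Musin–Tarasov 2012 Thm 1; registered on
stmt-15930 under this name since Sketch rev 3). -/
theorem stub_tammesThirteen : musinTarasov2012_tammes_thirteen := by
  sorry

/-- STUB 3 (OWN, NEW — `AllTwelveGap`, the everywhere-twelve tolerant Hales gap on the LIMIT OBJECT; pure discrete geometry,
GS-free): an everywhere locally-twelve point set of `ℝ³` (`55/57`-separated, every site with exactly twelve others within `1`)
has no pair of sites at distance in `(1, 21/17]`. [difficulty: L, certified computation at some finite radius, or an
infinite-volume argument] -/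
theorem stub_allTwelveGap : ∀ Y : Set (EuclideanSpace ℝ (Fin 3)),
    (∀ y ∈ Y, (∀ w ∈ Y, w ≠ y → (55 : ℝ) / 57 ≤ dist y w) ∧ {w ∈ Y | w ≠ y ∧ dist y w ≤ 1}.ncard = 12) →
    ∀ y ∈ Y, ∀ w ∈ Y, w ≠ y → dist y w ≤ 1 ∨ (21 : ℝ) / 17 < dist y w := by
  sorry

/-- STUB 4 (OWN — `LtgOfAllTwelveGap`, COMPACTNESS in the local rubber topology): CLOSED — it is the landed theorem
`Summit.AtomisticToContinuum.Crystallization.Theorems.stub_ltgOfAllTwelveGap` (p169958, strategist s3), restated here verbatim so the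
composition below reads unchanged. -/
theorem stub_ltgOfAllTwelveGap :
    (∀ T : Finset (EuclideanSpace ℝ (Fin 3)), (∀ v ∈ T, (55 : ℝ) / 57 ≤ ‖v‖ ∧ ‖v‖ ≤ 1) →
      (∀ v ∈ T, ∀ w ∈ T, v ≠ w → (55 : ℝ) / 57 ≤ dist v w) → T.card ≤ 12) →
    (∀ Y : Set (EuclideanSpace ℝ (Fin 3)),
      (∀ y ∈ Y, (∀ w ∈ Y, w ≠ y → (55 : ℝ) / 57 ≤ dist y w) ∧ {w ∈ Y | w ≠ y ∧ dist y w ≤ 1}.ncard = 12) →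
      ∀ y ∈ Y, ∀ w ∈ Y, w ≠ y → dist y w ≤ 1 ∨ (21 : ℝ) / 17 < dist y w) →
    ∃ n : ℕ, ∀ (N : ℕ) (X : Fin N → EuclideanSpace ℝ (Fin 3)) (i : Fin N),
      (∀ j : Fin N, dist (X i) (X j) ≤ (n : ℝ) →
        (∀ k : Fin N, dist (X j) (X k) ≤ 11 / 10 → ∀ l : Fin N, l ≠ k → (55 : ℝ) / 57 ≤ dist (X k) (X l)) ∧
        (Finset.univ.filter fun k : Fin N => k ≠ j ∧ dist (X j) (X k) ≤ 1).card = 12) →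
      ∀ j : Fin N, j ≠ i → dist (X i) (X j) ≤ 1 ∨ (21 : ℝ) / 17 ≤ dist (X i) (X j) :=
  Summit.AtomisticToContinuum.Crystallization.Theorems.stub_ltgOfAllTwelveGap

/-! ## Composition -/

/-- **The crux BY NAME from the four stubs** (closed form = the registered skeleton composition): `stub_ltgOfAllTwelveGap`
(fed with `ThickThirteen` from the Tammes stub via `RdvSplit.stub_thickThirteen_of_tammes`, p136458, and with
`stub_allTwelveGap`) gives `LTG_n` for some `n : ℕ`; the landed any-radius glue `radialDefectsVanish_of_locallyTwelveGapAt`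
(p151785; scale `a = 50/51` inside `RadialDefectsVanish_of_subs_at`, p136971) concludes. -/
theorem RadialDefectsVanish_of :
    Summit.AtomisticToContinuum.Crystallization.Theses.GappedShellCensus.RadialDefectsVanish := by
  obtain ⟨n, hn⟩ := stub_ltgOfAllTwelveGap
    (Summit.AtomisticToContinuum.Crystallization.Theorems.RdvSplit.stub_thickThirteen_of_tammes stub_tammesThirteen)
    stub_allTwelveGap
  exact Summit.AtomisticToContinuum.Crystallization.Theorems.radialDefectsVanish_of_locallyTwelveGapAt
    (R := (n : ℝ)) (Nat.cast_nonneg n) stub_tammesThirteen stub_twelveWithinOne hn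

/-- The same composition in arrow form (documentation of the reduction; hypotheses = the four stub statements, verbatim):
`TwelveWithinOne → Tammes-13 → AllTwelveGap → (ThickThirteen → AllTwelveGap → ∃ n, LTG_n) → RadialDefectsVanish`. -/
theorem radialDefectsVanish_of_stubs :
    (∀ x : (N : ℕ) → (Fin N → EuclideanSpace ℝ (Fin 3)), (∀ N, Literature.MathematicalPhysics.StatisticalMechanics.IsGroundState Literature.MathematicalPhysics.StatisticalMechanics.lennardJones (x N)) → Filter.Tendsto (fun N : ℕ => (Nat.card {i : Fin N // ¬ ((∀ j : Fin N, dist (x N i) (x N j) ≤ 11 / 10 → ∀ k : Fin N, k ≠ j → (55 : ℝ) / 57 ≤ dist (x N j) (x N k)) ∧ 12 ≤ (Finset.univ.filter fun j : Fin N => j ≠ i ∧ dist (x N i) (x N j) ≤ 1).card)} : ℝ) / N) Filter.atTop (nhds 0)) →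
    musinTarasov2012_tammes_thirteen →
    (∀ Y : Set (EuclideanSpace ℝ (Fin 3)),
      (∀ y ∈ Y, (∀ w ∈ Y, w ≠ y → (55 : ℝ) / 57 ≤ dist y w) ∧ {w ∈ Y | w ≠ y ∧ dist y w ≤ 1}.ncard = 12) →
      ∀ y ∈ Y, ∀ w ∈ Y, w ≠ y → dist y w ≤ 1 ∨ (21 : ℝ) / 17 < dist y w) →
    ((∀ T : Finset (EuclideanSpace ℝ (Fin 3)), (∀ v ∈ T, (55 : ℝ) / 57 ≤ ‖v‖ ∧ ‖v‖ ≤ 1) →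
        (∀ v ∈ T, ∀ w ∈ T, v ≠ w → (55 : ℝ) / 57 ≤ dist v w) → T.card ≤ 12) →
      (∀ Y : Set (EuclideanSpace ℝ (Fin 3)),
        (∀ y ∈ Y, (∀ w ∈ Y, w ≠ y → (55 : ℝ) / 57 ≤ dist y w) ∧ {w ∈ Y | w ≠ y ∧ dist y w ≤ 1}.ncard = 12) →
        ∀ y ∈ Y, ∀ w ∈ Y, w ≠ y → dist y w ≤ 1 ∨ (21 : ℝ) / 17 < dist y w) →
      ∃ n : ℕ, ∀ (N : ℕ) (X : Fin N → EuclideanSpace ℝ (Fin 3)) (i : Fin N),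
        (∀ j : Fin N, dist (X i) (X j) ≤ (n : ℝ) →
          (∀ k : Fin N, dist (X j) (X k) ≤ 11 / 10 → ∀ l : Fin N, l ≠ k → (55 : ℝ) / 57 ≤ dist (X k) (X l)) ∧
          (Finset.univ.filter fun k : Fin N => k ≠ j ∧ dist (X j) (X k) ≤ 1).card = 12) →
        ∀ j : Fin N, j ≠ i → dist (X i) (X j) ≤ 1 ∨ (21 : ℝ) / 17 ≤ dist (X i) (X j)) →
    Summit.AtomisticToContinuum.Crystallization.Theses.GappedShellCensus.RadialDefectsVanish := by
  intro h1 h2 h3 h4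
  obtain ⟨n, hn⟩ := h4 (Summit.AtomisticToContinuum.Crystallization.Theorems.RdvSplit.stub_thickThirteen_of_tammes h2) h3
  exact Summit.AtomisticToContinuum.Crystallization.Theorems.radialDefectsVanish_of_locallyTwelveGapAt
    (R := (n : ℝ)) (Nat.cast_nonneg n) h2 h1 hn

end Summit.AtomisticToContinuum.Crystallization.Cruxes.RadialDefectsVanish.AllTwelveGap

end
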